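import Mathlib
import Summits.ResolutionOfSingularities.ResolutionOfSingularities.Theorems.WildQuotientsWildQuotientResolutionJordanFiveMu2CoverSubstDefs
import Summits.ResolutionOfSingularities.ResolutionOfSingularities.Theorems.WildQuotientsWildQuotientResolutionJordanFiveMu2CoverDescent
import Summits.ResolutionOfSingularities.ResolutionOfSingularities.Theorems.WildQuotientsWildQuotientResolutionJordanFiveMu2CoverKL
import Summits.ResolutionOfSingularities.ResolutionOfSingularities.Theorems.WildQuotientsWildQuotientResolutionJordanFiveMu2CoverInvariantsRegular

/-!
# RUNG V5 (`J₅`), brick B7/HP₂ (W₂-A): the cover map `β = π ∘ coverSubst : k[x] → U₂` is injective, and `β(i₂³)·β((2j₃)²) ≠ 0`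
(crux stmt-ResolutionOfSingularities-15640 `WildQuotients.WildQuotientResolution`, line `Sketch`;
chain w45c RUNG V5, res-L1-w45c-plan-1 ORDER 2026-08-27T14:10:40Z (W₂-A)
`JordanFive.exists_chartW₂_away_ringEquiv_fixedTau` — the two hypotheses `hβ`, `hnzd` of the cover
engine `BlowupExit.exists_ringEquiv_subalgebra_of_coverData`; written by res-D-pv-033 AS
res-L1-w45c-stub-5, on res-type-036's cover letters (`coverSubst`, `coverPhi`, `coverIHat`,
`U = (k[s,Y,pass] ⧸ I)[1/ι]`, `I = (Φ)`, `ι = î`). [OURS · L1 W4.5c] — NOT a statement of any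
manuscript; replaces the role of no printed item.)

* `iTwo_ne_zero`, `jThreeTwo_ne_zero` — the two invariants are non-zero polynomials (value at the
  point `x_c = 1`).
* `X_pow_six_mul_coverPhi` — `s⁶·Φ(s,Y) = 2s²·coverSubst(i₂) + coverSubst(2j₃)` (the cover equation IS
  `s²i₂ + j₃ = 0` read through the substitution).
* **`coverSubst_algebraMap_injective`** — `F ↦ π(coverSubst F)` is injective `k[x] → U`. Proof without
  any grading argument: the auxiliary ring `K' = K[X]/(2i₂X² + 2j₃)`, `K = Frac k[x]`, receives `U`
  (`s ↦ X̄`, `Y_i ↦ x_i·X̄^{−w_i}`, `Φ ↦ 0`, `î ↦` unit) compatibly with `k[x] ↪ K ↪ K'`.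
* **`coverSubst_algebraMap_iTwo_jThreeTwo_ne_zero`** — `π(coverSubst(i₂³))·π(coverSubst((2j₃)²)) ≠ 0`
  in the domain `U` (`Φ` prime, `Φ ∤ s, î`, and `Φ ∤ ĵ` because `ĵ ≡ −2î`).
-/

-- single-problem summit: the doubled namespace component `ResolutionOfSingularities` is forced
set_option linter.dupNamespace false

noncomputable section

open MvPolynomial Polynomial

namespace Summit.ResolutionOfSingularities.ResolutionOfSingularities.Theorems.WildQuotientResolution.JordanFive

variable (k : Type) [Field k] (n : ℕ) (a b c d e : Fin n)
  (hab : a ≠ b) (hac : a ≠ c) (had : a ≠ d) (hae : a ≠ e) (hbc : b ≠ c) (hbd : b ≠ d)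
  (hbe : b ≠ e) (hcd : c ≠ d) (hce : c ≠ e) (hde : d ≠ e)

/-! ## Non-vanishing of `i₂`, `2j₃` -/

include hac hbc hcd hce in
/-- `i₂ ≠ 0` (its value at `x_c = 1`, all other variables `0`, is `1`). [OURS · L1 W4.5c] -/
theorem iTwo_ne_zero : iTwo k n a b c d e ≠ 0 := by
  classical
  intro h
  have hv := congrArg (MvPolynomial.eval fun i => if i = c then (1 : k) else 0) h
  simp only [iTwo, map_add, map_sub, map_mul, map_pow, map_ofNat, MvPolynomial.eval_X, map_zero,
    if_neg hac, if_neg hbc, if_neg hcd.symm, if_neg hce.symm] at hv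
  norm_num at hv

include hac hbc hcd hce in
/-- `2j₃ ≠ 0` when `2 ≠ 0` (its value at `x_c = 1`, all other variables `0`, is `−2`).
[OURS · L1 W4.5c] -/
theorem jThreeTwo_ne_zero (h2 : (2 : k) ≠ 0) : jThreeTwo k n a b c d e ≠ 0 := by
  classical
  intro h
  have hv := congrArg (MvPolynomial.eval fun i => if i = c then (1 : k) else 0) h
  simp only [jThreeTwo, map_add, map_sub, map_mul, map_pow, map_ofNat, MvPolynomial.eval_X,
    map_zero, if_neg hac, if_neg hbc, if_neg hcd.symm, if_neg hce.symm] at hv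
  norm_num at hv
  exact h2 hv

/-! ## The cover equation through the substitution -/

include hab hac had hae hbc hbd hbe hcd hce hde in
/-- **`s⁶·Φ = 2s²·coverSubst(i₂) + coverSubst(2j₃)`** in `k[s, Y, pass]`. [OURS · L1 W4.5c] -/
theorem X_pow_six_mul_coverPhi :
    (X none : MvPolynomial (Option (Fin n)) k) ^ 6 *
        coverPhi (X none) (X (some a)) (X (some b)) (X (some c)) (X (some d)) (X (some e)) =
      2 * X none ^ 2 * coverSubst k n a b c d (iTwo k n a b c d e) +
        coverSubst k n a b c d (jThreeTwo k n a b c d e) := by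
  rw [coverSubst_iTwo k n a b c d e hab hac had hae hbc hbd hbe hcd hce hde,
    coverSubst_jThreeTwo k n a b c d e hab hac had hae hbc hbd hbe hcd hce hde, coverPhi_def]
  ring

/-! ## Injectivity of `β = π ∘ coverSubst` -/

section Injective

variable (I : Ideal (MvPolynomial (Option (Fin n)) k)) (ι : MvPolynomial (Option (Fin n)) k)
  (hI : I = Ideal.span {coverPhi (X none) (X (some a)) (X (some b)) (X (some c)) (X (some d))
    (X (some e) : MvPolynomial (Option (Fin n)) k)})
  (hι : ι = coverIHat (X none) (X (some a)) (X (some b)) (X (some c)) (X (some d)) (X (some e)))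
  (U : Type) [CommRing U] [Algebra (MvPolynomial (Option (Fin n)) k ⧸ I) U]
  [IsLocalization.Away (Ideal.Quotient.mk I ι) U]

include hab hac had hae hbc hbd hbe hcd hce hde hI hι in
-- three nested universal properties (quotient, localisation, `AdjoinRoot`): head-room
set_option maxHeartbeats 1600000 in
/-- **`β = π ∘ coverSubst : k[x] → U` is injective** (`2 ≠ 0`). The auxiliary ring
`K' = K[X]/(2i₂X² + 2j₃)` over `K = Frac k[x]` receives `U` by `s ↦ X̄`, `Y_i ↦ x_i X̄^{−w_i}`
(`Φ ↦ X̄⁻⁶(2X̄²i₂ + 2j₃) = 0`, `î ↦ X̄⁻⁴ i₂` a unit), and the composite `k[x] → U → K'` is the injection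
`k[x] ↪ K ↪ K'`. [OURS · L1 W4.5c] -/
theorem coverSubst_algebraMap_injective (h2 : (2 : k) ≠ 0) :
    Function.Injective fun F : MvPolynomial (Fin n) k =>
      algebraMap _ U (Ideal.Quotient.mk I (coverSubst k n a b c d F)) := by
  classical
  -- the field `K = Frac k[x]` and the two invariants there
  set K : Type := FractionRing (MvPolynomial (Fin n) k) with hK
  set ιK : MvPolynomial (Fin n) k →+* K := algebraMap (MvPolynomial (Fin n) k) K with hιK
  have hιKinj : Function.Injective ιK := IsFractionRing.injective (MvPolynomial (Fin n) k) K
  have hi0 : ιK (iTwo k n a b c d e) ≠ 0 :=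
    (map_ne_zero_iff ιK hιKinj).mpr (iTwo_ne_zero k n a b c d e hac hbc hcd hce)
  have hj0 : ιK (jThreeTwo k n a b c d e) ≠ 0 :=
    (map_ne_zero_iff ιK hιKinj).mpr (jThreeTwo_ne_zero k n a b c d e hac hbc hcd hce h2)
  have h2K : (2 : K) ≠ 0 := by
    have h := (map_ne_zero_iff ιK hιKinj).mpr
      ((map_ne_zero_iff (MvPolynomial.C (σ := Fin n)) (MvPolynomial.C_injective _ _)).mpr h2)
    rwa [map_ofNat, map_ofNat] at h
  -- `K' = K[X]/(2i₂X² + 2j₃)` and the class `r` of `X`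
  set f : K[X] := Polynomial.C (2 * ιK (iTwo k n a b c d e)) * Polynomial.X ^ 2 +
    Polynomial.C (ιK (jThreeTwo k n a b c d e)) with hf
  have hfdeg : f.degree ≠ 0 := by
    have h1 : (Polynomial.C (2 * ιK (iTwo k n a b c d e)) * Polynomial.X ^ 2 : K[X]).degree = 2 :=
      Polynomial.degree_C_mul_X_pow 2 (mul_ne_zero h2K hi0)
    rw [hf, Polynomial.degree_add_C (by rw [h1]; norm_num), h1]
    norm_num
  set K' : Type := AdjoinRoot f with hK'
  set of' : K →+* K' := AdjoinRoot.of f with hof'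
  have hofinj : Function.Injective of' := AdjoinRoot.of.injective_of_degree_ne_zero hfdeg
  set r : K' := AdjoinRoot.root f with hr
  have hroot : 2 * of' (ιK (iTwo k n a b c d e)) * r ^ 2 + of' (ιK (jThreeTwo k n a b c d e)) = 0 := by
    have h : Polynomial.eval₂ of' r (Polynomial.C (2 * ιK (iTwo k n a b c d e)) * Polynomial.X ^ 2 +
        Polynomial.C (ιK (jThreeTwo k n a b c d e))) = 0 := AdjoinRoot.eval₂_root f
    rwa [Polynomial.eval₂_add, Polynomial.eval₂_mul, Polynomial.eval₂_C, Polynomial.eval₂_X_pow,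
      Polynomial.eval₂_C, map_mul, map_ofNat] at h
  -- `r` is a unit: `r · (r · (−2i₂/2j₃)) = 1`
  set m : K := -(2 * ιK (iTwo k n a b c d e)) * (ιK (jThreeTwo k n a b c d e))⁻¹ with hm
  have hrm : r * (r * of' m) = 1 := by
    have hj1 : of' (ιK (jThreeTwo k n a b c d e)) * of' ((ιK (jThreeTwo k n a b c d e))⁻¹) = 1 := by
      rw [← map_mul, mul_inv_cancel₀ hj0, map_one]
    have e1 : 2 * of' (ιK (iTwo k n a b c d e)) * r ^ 2 = -of' (ιK (jThreeTwo k n a b c d e)) :=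
      eq_neg_of_add_eq_zero_left hroot
    calc r * (r * of' m) = -(2 * of' (ιK (iTwo k n a b c d e)) * r ^ 2) *
          of' ((ιK (jThreeTwo k n a b c d e))⁻¹) := by
            rw [hm, map_mul, map_neg, map_mul, map_ofNat]; ring
      _ = 1 := by rw [e1, neg_neg, hj1]
  have hru : IsUnit r := IsUnit.of_mul_eq_one _ hrm
  set rinv : K' := r * of' m with hrinv
  have hrrinv : r * rinv = 1 := hrm
  -- the evaluation `ev : k[s, Y, pass] → K'`
  let wt : Fin n → ℕ := fun i => if i = a then 4 else if i = b then 3 else if i = c then 2 else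
    if i = d then 1 else 0
  let v : Option (Fin n) → K' := fun o => Option.casesOn o r (fun i => of' (ιK (X i)) * rinv ^ wt i)
  set ev : MvPolynomial (Option (Fin n)) k →+* K' :=
    MvPolynomial.eval₂Hom (of'.comp (ιK.comp MvPolynomial.C)) v with hev
  have hev_none : ev (X none) = r := by rw [hev, MvPolynomial.coe_eval₂Hom, MvPolynomial.eval₂_X]
  have hev_some : ∀ i, ev (X (some i)) = of' (ιK (X i)) * rinv ^ wt i := fun i => by
    rw [hev, MvPolynomial.coe_eval₂Hom, MvPolynomial.eval₂_X]
  have hwa : wt a = 4 := by simp [wt]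
  have hwb : wt b = 3 := by simp [wt, Ne.symm hab]
  have hwc : wt c = 2 := by simp [wt, Ne.symm hac, Ne.symm hbc]
  have hwd : wt d = 1 := by simp [wt, Ne.symm had, Ne.symm hbd, Ne.symm hcd]
  have hw0 : ∀ i, i ≠ a → i ≠ b → i ≠ c → i ≠ d → wt i = 0 := fun i hia hib hic hid => by
    simp [wt, hia, hib, hic, hid]
  have hpow : ∀ m' : ℕ, r ^ m' * rinv ^ m' = 1 := fun m' => by rw [← mul_pow, hrrinv, one_pow]
  -- `ev ∘ coverSubst = of' ∘ ιK`
  have hevC : ∀ F : MvPolynomial (Fin n) k, ev (coverSubst k n a b c d F) = of' (ιK F) := by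
    intro F
    have key : ev.comp (coverSubst k n a b c d : MvPolynomial (Fin n) k →+* _) = of'.comp ιK := by
      refine MvPolynomial.ringHom_ext (fun t => ?_) (fun i => ?_)
      · change ev (coverSubst k n a b c d (MvPolynomial.C t)) = of' (ιK (MvPolynomial.C t))
        rw [coverSubst_C, hev, MvPolynomial.coe_eval₂Hom, MvPolynomial.eval₂_C]
        rfl
      · change ev (coverSubst k n a b c d (X i)) = of' (ιK (X i))
        by_cases hia : i = a
        · subst hia
          rw [coverSubst_X_a, map_mul, map_pow, hev_none, hev_some, hwa, ← mul_assoc,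
            mul_comm (r ^ 4), mul_assoc, hpow, mul_one]
        by_cases hib : i = b
        · subst hib
          rw [coverSubst_X_b k n a i c d hab, map_mul, map_pow, hev_none, hev_some, hwb, ← mul_assoc,
            mul_comm (r ^ 3), mul_assoc, hpow, mul_one]
        by_cases hic : i = c
        · subst hic
          rw [coverSubst_X_c k n a b i d hac hbc, map_mul, map_pow, hev_none, hev_some, hwc,
            ← mul_assoc, mul_comm (r ^ 2), mul_assoc, hpow, mul_one]
        by_cases hid : i = d
        · subst hid
          rw [coverSubst_X_d k n a b c i had hbd hcd, map_mul, hev_none, hev_some, hwd, ← mul_assoc,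
            mul_comm r, mul_assoc, pow_one, hrrinv, mul_one]
        · rw [coverSubst_X_of_ne k n a b c d i hia hib hic hid, hev_some, hw0 i hia hib hic hid,
            pow_zero, mul_one]
    exact RingHom.congr_fun key F
  -- `ev Φ = 0`
  have hevΦ : ev (coverPhi (X none) (X (some a)) (X (some b)) (X (some c)) (X (some d))
      (X (some e))) = 0 := by
    have h := congrArg ev (X_pow_six_mul_coverPhi k n a b c d e hab hac had hae hbc hbd hbe hcd hce hde)
    rw [map_mul, map_pow, hev_none, map_add, map_mul, map_mul, map_ofNat, map_pow, hev_none, hevC,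
      hevC] at h
    have h0 : r ^ 6 * ev (coverPhi (X none) (X (some a)) (X (some b)) (X (some c)) (X (some d))
        (X (some e))) = 0 := by
      calc _ = 2 * r ^ 2 * of' (ιK (iTwo k n a b c d e)) + of' (ιK (jThreeTwo k n a b c d e)) := h
        _ = 2 * of' (ιK (iTwo k n a b c d e)) * r ^ 2 + of' (ιK (jThreeTwo k n a b c d e)) := by ring
        _ = 0 := hroot
    exact ((hru.pow 6).mul_right_eq_zero).mp h0
  -- `ev î` is a unit
  have hevι : IsUnit (ev ι) := by
    have h := congrArg ev (coverSubst_iTwo k n a b c d e hab hac had hae hbc hbd hbe hcd hce hde)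
    rw [hevC, map_mul, map_pow, hev_none] at h
    have hu : IsUnit (r ^ 4 * ev ι) := by
      rw [hι, ← h]
      exact (Ne.isUnit hi0).map of'
    exact isUnit_of_mul_isUnit_right hu
  -- through the quotient and the localisation
  have hIev : ∀ x ∈ I, ev x = 0 := by
    intro x hx
    rw [hI] at hx
    obtain ⟨q, rfl⟩ := Ideal.mem_span_singleton'.mp hx
    rw [map_mul, hevΦ, mul_zero]
  let evQ : (MvPolynomial (Option (Fin n)) k ⧸ I) →+* K' := Ideal.Quotient.lift I ev hIev
  have hevQ : ∀ x, evQ (Ideal.Quotient.mk I x) = ev x := fun x => Ideal.Quotient.lift_mk I ev hIev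
  have hunit : IsUnit (evQ (Ideal.Quotient.mk I ι)) := by rw [hevQ]; exact hevι
  let ω : U →+* K' := IsLocalization.Away.lift (Ideal.Quotient.mk I ι) hunit
  have hω : ∀ x, ω (algebraMap _ U (Ideal.Quotient.mk I x)) = ev x := fun x => by
    change IsLocalization.Away.lift (Ideal.Quotient.mk I ι) hunit _ = _
    rw [IsLocalization.Away.lift_eq, hevQ]
  -- conclusion
  intro F₁ F₂ hF
  have h := congrArg ω hF
  change ω (algebraMap _ U (Ideal.Quotient.mk I (coverSubst k n a b c d F₁))) =
    ω (algebraMap _ U (Ideal.Quotient.mk I (coverSubst k n a b c d F₂))) at h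
  rw [hω, hω, hevC, hevC] at h
  exact hιKinj (hofinj h)

include hab hac had hae hbc hbd hbe hcd hce hde hI hι in
/-- **`β(i₂³)·β((2j₃)²) ≠ 0` in `U`** (`2, 3 ≠ 0`): `U` is a domain and
`coverSubst(i₂³)·coverSubst((2j₃)²) = s²⁴ î³ ĵ² ∉ (Φ)` (`Φ` prime; `Φ ∤ s`, `Φ ∤ î`, and `Φ ∤ ĵ` since
`ĵ = Φ − 2î`). [OURS · L1 W4.5c] -/
theorem coverSubst_algebraMap_iTwo_jThreeTwo_ne_zero (h2 : (2 : k) ≠ 0) (h3 : (3 : k) ≠ 0) :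
    algebraMap _ U (Ideal.Quotient.mk I (coverSubst k n a b c d (iTwo k n a b c d e ^ 3))) *
        algebraMap _ U (Ideal.Quotient.mk I (coverSubst k n a b c d (jThreeTwo k n a b c d e ^ 2))) ≠
      0 := by
  classical
  haveI : IsDomain (MvPolynomial (Option (Fin n)) k ⧸ I) := by
    rw [hI]; exact isDomain_quotient_coverPhi k n a b c d e hab hac hae hbc hbe hce hde h2 h3
  have hιI : ι ∉ I := by
    rw [hI, hι]; exact coverIHat_notMem_span_coverPhi k n a b c d e hac hbc hcd hce
  rw [← map_mul, ← map_mul, Ne, algebraMap_mk_eq_zero_iff k n I ι U hιI, map_pow, map_pow,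
    coverSubst_iTwo k n a b c d e hab hac had hae hbc hbd hbe hcd hce hde,
    coverSubst_jThreeTwo k n a b c d e hab hac had hae hbc hbd hbe hcd hce hde, hI,
    Ideal.mem_span_singleton]
  have hP := coverPhi_prime k n a b c d e hab hac hae hbc hbe hce hde h2 h3
  have hs : ¬ coverPhi (X none) (X (some a)) (X (some b)) (X (some c)) (X (some d))
      (X (some e) : MvPolynomial (Option (Fin n)) k) ∣ X none :=
    not_coverPhi_dvd_X k n a b c d e hab hac hae hbc hbe hcd hce hde h2 h3 none (Option.some_ne_none c).symm
  have hî : ¬ coverPhi (X none) (X (some a)) (X (some b)) (X (some c)) (X (some d))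
      (X (some e) : MvPolynomial (Option (Fin n)) k) ∣
      coverIHat (X none) (X (some a)) (X (some b)) (X (some c)) (X (some d)) (X (some e)) := fun h =>
    coverIHat_notMem_span_coverPhi k n a b c d e hac hbc hcd hce (Ideal.mem_span_singleton.mpr h)
  have hĵ : ¬ coverPhi (X none) (X (some a)) (X (some b)) (X (some c)) (X (some d))
      (X (some e) : MvPolynomial (Option (Fin n)) k) ∣
      coverJHat (X none) (X (some a)) (X (some b)) (X (some c)) (X (some d)) (X (some e)) := by
    intro h
    have h' : coverPhi (X none) (X (some a)) (X (some b)) (X (some c)) (X (some d))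
        (X (some e) : MvPolynomial (Option (Fin n)) k) ∣
        MvPolynomial.C 2 * coverIHat (X none) (X (some a)) (X (some b)) (X (some c)) (X (some d))
          (X (some e)) := by
      have e1 : MvPolynomial.C (2 : k) * coverIHat (X none) (X (some a)) (X (some b)) (X (some c))
          (X (some d)) (X (some e) : MvPolynomial (Option (Fin n)) k) =
          coverPhi (X none) (X (some a)) (X (some b)) (X (some c)) (X (some d)) (X (some e)) -
            coverJHat (X none) (X (some a)) (X (some b)) (X (some c)) (X (some d)) (X (some e)) := by
        rw [coverPhi_def, map_ofNat]; ring
      rw [e1]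
      exact dvd_sub (dvd_refl _) h
    rcases hP.dvd_or_dvd h' with h1 | h1
    · exact hP.not_unit (isUnit_of_dvd_unit h1 ((Ne.isUnit h2).map MvPolynomial.C))
    · exact hî h1
  intro h
  rcases hP.dvd_or_dvd h with h1 | h1
  · rcases hP.dvd_or_dvd (hP.dvd_of_dvd_pow h1) with h11 | h11
    · exact hs (hP.dvd_of_dvd_pow h11)
    · exact hî h11
  · rcases hP.dvd_or_dvd (hP.dvd_of_dvd_pow h1) with h11 | h11
    · exact hs (hP.dvd_of_dvd_pow h11)
    · exact hĵ h11

end Injective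

end Summit.ResolutionOfSingularities.ResolutionOfSingularities.Theorems.WildQuotientResolution.JordanFive

end
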